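import Literature.AlgebraicGeometry.Resolution.LipmanValuativeQuadraticSequenceProofs
import Literature.AlgebraicGeometry.Resolution.ArithmeticalThreefoldsLocalChart
import HarnessLib

/-!
# The prescribed-point half of the blow-up / valuation dictionary: the local ring of a GIVEN point of the point blow-up,
# dominated by a valuation ring `O`, IS the quadratic transform of the local ring of the centre along `O` (Stacks 0804; Cutkosky §2.2)

Topic: `Literature/AlgebraicGeometry/Resolution`. Folklore blow-up algebra, sibling of `LipmanValuativeQuadraticSequenceProofs.lean`
(the EXISTENCE half `IsBlowup.exists_point_range_eq_locAtCentre_blowupRing` and the chart computation `IsBlowup.range_comp_stalkEmb_of_chart`).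
MOTIVATION (cell res-hironaka, LADDER-RESOLUTION rung L, slot W4.2):

Crux chain w42 (`SigmaMaxModifications`, stmt-ResolutionOfSingularities-18506; conjunct `SigmaMaxModificationsCorridor3`, stmt-…-19249),
line `w_ladder`, registered stubs `stub_isoInsepTower` / `stub_isoSepRecurrent` (the residual of the isolated kernel
`IsoQuadraticTowerTerminates p 3`). Lead res-L1-w42-lead-1 (gen 5); no definition, no named fact. STEP 1 of the scheme ↔ ring dictionary turning `IdeasL1C5.false_of_hsIsolated_singular_pointTower_of_CP`
(`…WLadderIsoKernelCPFrame`, p547474: the kernel in Cossart–Piltant's frame, whose towers are `T : ℕ → Subring L` with every `T (i+1)` THE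
quadratic transform of `T i` along a valuation ring `O`) into a statement about the scheme-level isolated point towers `IsIsoPointTower`.

WHAT IS PROVED. Let `π : X' → X` be a blowing up along `J` (`IsBlowup π J`) of an integral locally Noetherian scheme, `x' ∈ X'` a point whose
image `s = π x'` has `J_s = 𝔪_s` (e.g. the blow-up of the closed point `s`), `F : K(X) → K` a field homomorphism and `O` a valuation ring of
`K` DOMINATING the local ring `𝒪_{X',x'}` read in `K` through the canonical embedding `ε_{x'} : 𝒪_{X',x'} ↪ K(X)` (tree `IsBlowup.stalkEmb`,
res-… `BlowupStalkEmbedding.lean`): `F(ε(𝒪_{X',x'})) ⊆ O` and `F(ε(𝔪_{x'})) ⊆ 𝔪_O`. Then (`IsBlowup.isQuadraticTransformAlong_range_stalkEmb`)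

  `F(ε(𝒪_{X',x'})) = (R[𝔪_R/x])_{𝔪_O ∩ R[𝔪_R/x]}`, `R := F(𝒪_{X,s})` — i.e. `IsQuadraticTransformAlong O R (F ∘ ε_{x'}).range`:

the local ring of the PRESCRIBED point `x'` is the quadratic transform of `R` along `O` (Cutkosky §2.2; unique by
`IsQuadraticTransformAlong.unique`). The tree had the EXISTENCE half (`IsBlowup.exists_point_range_eq_locAtCentre_blowupRing`: SOME point `x'`
over `s` has this local ring) and the chart computation `IsBlowup.range_comp_stalkEmb_of_chart` (given a chart through `x'` AT THE CENTRE of `O`);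
here the chart data are DERIVED from domination: every chart `Spec B_j → X'` through `x'` (`IsBlowup.exists_chart_morphism`) has `c_j` of
maximal value (the fractions `c_i/c_j` lie in `𝒪_{X',x'} ⊆ O`) and carries `x'` at the centre `𝔪_O ∩ B_j` of `O` (domination). Also
`IsBlowup.mem_maximalIdeal_iff_of_dominates` (domination of `𝒪_{X,s}` follows from domination of `𝒪_{X',x'}`).

HONEST FRAMING. Folklore blow-up algebra (Stacks 0804) assembled over the tree's chart kit; nothing here is a statement of H. Hironaka's
manuscript [Hironaka2017] nor of [CossartJannsenSaito2020] / [CossartPiltant2019]. AI-written; AI review is weaker than expert review.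

## Sources

* The Stacks Project, Tag 0804 (affine charts of a blowing up). [StacksProject]
* S. D. Cutkosky, *A counterexample to strong local monomialization in a tower of two algebraic extensions* (2014), §2.1–2.2
  (quadratic transforms along a valuation). [Cutkosky2014]
* J. Kollár, *Lectures on resolution of singularities* (2007), §1.4. [Kollar2007]
-/

noncomputable section

set_option linter.dupNamespace false

open IsLocalRing AlgebraicGeometry CategoryTheory
open Literature.AlgebraicGeometry.Resolution

namespace Literature.AlgebraicGeometry.Resolution

universe u

open Scheme.IdealSheafData Limits

variable {X' X : Scheme.{u}} {π : X' ⟶ X} {J : X.IdealSheafData}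
variable [IsIntegral X] [IsLocallyNoetherian X] {K : Type u} [Field K] (O : ValuationSubring K)

/-- The valuation of the image of an element of an ideal is bounded by the maximal valuation of the images of its generators. [folklore] -/
private theorem valuation_map_le_of_mem_span {A : Type*} [CommRing A] (θ : A →+* K)
    (hRO : ∀ r, θ r ∈ O) {m : ℕ} (c : Fin m → A) (j : Fin m)
    (hmin : ∀ i, O.valuation (θ (c i)) ≤ O.valuation (θ (c j))) {r : A}
    (hr : r ∈ Ideal.span (Set.range c)) : O.valuation (θ r) ≤ O.valuation (θ (c j)) := by
  induction hr using Submodule.span_induction with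
  | mem y hy =>
    obtain ⟨i, rfl⟩ := hy
    exact hmin i
  | zero => simp
  | add y z _ _ hy hz =>
    rw [map_add]
    exact (Valuation.map_add _ _ _).trans (max_le hy hz)
  | smul a y _ hy =>
    rw [smul_eq_mul, map_mul, map_mul]
    calc O.valuation (θ a) * O.valuation (θ y) ≤ 1 * O.valuation (θ (c j)) :=
          mul_le_mul' ((O.valuation_le_one_iff _).mpr (hRO a)) hy
      _ = O.valuation (θ (c j)) := one_mul _

/-- In a local ring read inside `O`, an element of value `1` is a unit iff… precisely: a UNIT has value `1` (both it and its inverse have value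
`≤ 1`). [folklore] -/
private theorem valuation_map_eq_one_of_isUnit_of_forall_mem {A : Type*} [CommRing A] (g : A →+* K) (hO : ∀ r, g r ∈ O) {r : A} (hr : IsUnit r) :
    O.valuation (g r) = 1 := by
  obtain ⟨v, rfl⟩ := hr
  have h1 : O.valuation (g (v : A)) * O.valuation (g (↑v⁻¹ : A)) = 1 := by
    rw [← map_mul, ← map_mul, Units.mul_inv, map_one, map_one]
  have ha : O.valuation (g (v : A)) ≤ 1 := (O.valuation_le_one_iff _).mpr (hO _)
  have hb : O.valuation (g (↑v⁻¹ : A)) ≤ 1 := (O.valuation_le_one_iff _).mpr (hO _)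
  refine le_antisymm ha ?_
  by_contra hlt
  push Not at hlt
  have : O.valuation (g (v : A)) * O.valuation (g (↑v⁻¹ : A)) < 1 * 1 :=
    mul_lt_mul_of_lt_of_le_of_nonneg_of_pos hlt hb zero_le zero_lt_one
  rw [h1, one_mul] at this
  exact lt_irrefl _ this

/-- For a local ring read inside `O` with its maximal ideal mapping into `𝔪_O`: membership in the maximal ideal IS positivity of the value.
[folklore] -/
private theorem mem_maximalIdeal_iff_valuation_map_lt_one_of_dominates {A : Type*} [CommRing A] [IsLocalRing A] (g : A →+* K) (hO : ∀ r, g r ∈ O)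
    (hdom : ∀ r, r ∈ maximalIdeal A → O.valuation (g r) < 1) (r : A) :
    r ∈ maximalIdeal A ↔ O.valuation (g r) < 1 := by
  refine ⟨hdom r, fun h => ?_⟩
  by_contra hr
  have hu : IsUnit r := by
    by_contra hnu
    exact hr ((IsLocalRing.mem_maximalIdeal _).mpr hnu)
  exact (lt_irrefl _) ((valuation_map_eq_one_of_isUnit_of_forall_mem O g hO hu) ▸ h)

/-- **Domination descends to the centre**: if `O` dominates `𝒪_{X',x'}` (read in `K` through `ε_{x'}` and `F`), it dominates `𝒪_{X,π x'}`
(read through `ψ = F ∘ (𝒪_{X,π x'} ⊆ K(X))`), `π^♯_{x'}` being a local homomorphism with `ε_{x'} ∘ π^♯_{x'} = (𝒪_{X,π x'} ⊆ K(X))` (Cutkosky §2.1: a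
quadratic transform along `ν` dominates its source). [cite: Cutkosky2014, §2.1] -/
theorem IsBlowup.mem_maximalIdeal_iff_of_dominates (hπ : IsBlowup π J) (x' : X') (F : X.functionField →+* K)
    (ψ : X.presheaf.stalk (π x') →+* K) (hFθ : F.comp (algebraMap (X.presheaf.stalk (π x')) X.functionField) = ψ)
    (hO : ∀ r, F (hπ.stalkEmb x' r) ∈ O)
    (hdom : ∀ r, r ∈ maximalIdeal (X'.presheaf.stalk x') → O.valuation (F (hπ.stalkEmb x' r)) < 1)
    (a : X.presheaf.stalk (π x')) :
    a ∈ maximalIdeal (X.presheaf.stalk (π x')) ↔ O.valuation (ψ a) < 1 := by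
  have hε : ψ a = F (hπ.stalkEmb x' ((π.stalkMap x').hom a)) := by
    rw [hπ.stalkEmb_stalkMap, ← hFθ]
    rfl
  have key := mem_maximalIdeal_iff_valuation_map_lt_one_of_dominates O (F.comp (hπ.stalkEmb x')) hO hdom ((π.stalkMap x').hom a)
  have key' : (π.stalkMap x').hom a ∈ maximalIdeal (X'.presheaf.stalk x') ↔ O.valuation (ψ a) < 1 := by
    rw [hε]; exact key
  have hlh : a ∈ maximalIdeal (X.presheaf.stalk (π x')) ↔ (π.stalkMap x').hom a ∈ maximalIdeal (X'.presheaf.stalk x') := by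
    rw [IsLocalRing.mem_maximalIdeal, IsLocalRing.mem_maximalIdeal, mem_nonunits_iff, mem_nonunits_iff,
      isUnit_map_iff]
  exact hlh.trans key'

set_option maxHeartbeats 800000 in
-- the chart kit (`exists_chart_morphism`, `exists_stalk_ringHom_of_chart`, `range_comp_stalkEmb_of_chart`) elaborates large `Proj` terms
/-- **THE LOCAL RING OF A PRESCRIBED POINT OF THE POINT BLOW-UP, DOMINATED BY `O`, IS THE QUADRATIC TRANSFORM ALONG `O`** (frame with an explicit
name `R` for `F(𝒪_{X,π x'})` and `ψ` for `F ∘ (𝒪_{X,π x'} ⊆ K(X))`). Let `π : X' → X` be a blowing up along `J` of an integral locally Noetherian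
scheme, `x' ∈ X'` with `J_{π x'} = 𝔪_{π x'}`, `F : K(X) → K` a field homomorphism and `O` a valuation ring of `K` dominating `F(ε_{x'}(𝒪_{X',x'}))`.
Then `F(ε_{x'}(𝒪_{X',x'}))` is the quadratic transform of `R` along `O`: `(R[𝔪_R/c_j])_{𝔪_O ∩ R[𝔪_R/c_j]}` for a generator `c_j` of `𝔪` of
maximal value (Stacks 0804 charts: every chart through `x'` has `c_j` of maximal value and carries `x'` at the centre of `O`).
[cite: StacksProject, Tag 0804] [cite: Cutkosky2014, §2.2] -/
theorem IsBlowup.isQuadraticTransformAlong_range_stalkEmb_of_range_eq (hπ : IsBlowup π J) (x' : X')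
    (hJ : stalkIdeal J (π x') = maximalIdeal (X.presheaf.stalk (π x')))
    (F : X.functionField →+* K) (ψ : X.presheaf.stalk (π x') →+* K)
    (hFθ : F.comp (algebraMap (X.presheaf.stalk (π x')) X.functionField) = ψ)
    (R : Subring K) [IsLocalRing R] (hR : ψ.range = R)
    (hO : ∀ r, F (hπ.stalkEmb x' r) ∈ O)
    (hdom : ∀ r, r ∈ maximalIdeal (X'.presheaf.stalk x') → O.valuation (F (hπ.stalkEmb x' r)) < 1) :
    IsQuadraticTransformAlong O R (F.comp (hπ.stalkEmb x')).range := by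
  classical
  have hψ : Function.Injective ψ := by
    rw [← hFθ]
    exact F.injective.comp (IsFractionRing.injective (X.presheaf.stalk (π x')) X.functionField)
  -- domination of the centre's local ring
  have hdom₀ : ∀ a, a ∈ maximalIdeal (X.presheaf.stalk (π x')) ↔ O.valuation (ψ a) < 1 :=
    fun a => hπ.mem_maximalIdeal_iff_of_dominates O x' F ψ hFθ hO hdom a
  have hRO' : ∀ a, ψ a ∈ O := fun a => by
    have h : ψ a = F (hπ.stalkEmb x' ((π.stalkMap x').hom a)) := by
      rw [hπ.stalkEmb_stalkMap, ← hFθ]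
      rfl
    rw [h]
    exact hO _
  have hmemR : ∀ a, ψ a ∈ R := fun a => hR ▸ ⟨a, rfl⟩
  have hRO : R ≤ O.toSubring := by
    intro z hz
    obtain ⟨a, rfl⟩ : z ∈ ψ.range := hR ▸ hz
    exact hRO' a
  -- generators of `𝔪 = J_s` and a chart through `x'`
  obtain ⟨m, c, hc⟩ := exists_fin_span_eq_stalkIdeal J (π x')
  have hc' : Ideal.span (Set.range c) = maximalIdeal (X.presheaf.stalk (π x')) := hc.trans hJ
  obtain ⟨j, w, q, hqw, hqiso, hsq⟩ := hπ.exists_chart_morphism x' c hc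
  haveI := hqiso
  obtain ⟨χ, hχ, hloc, -⟩ := exists_stalk_ringHom_of_chart π x' (CommRingCat.ofHom (chartBase c j)) q _ hqw hsq
  letI : Algebra (chartRing c j) (X'.presheaf.stalk x') := χ.toAlgebra
  haveI : IsLocalization.AtPrime (X'.presheaf.stalk x') w.asIdeal := hloc
  -- `c_j ≠ 0`
  haveI : Nontrivial (chartRing c j) := ⟨⟨0, 1, fun h0 =>
    w.isPrime.ne_top ((Ideal.eq_top_iff_one w.asIdeal).mpr (h0 ▸ w.asIdeal.zero_mem))⟩⟩
  have hφcj : chartBase c j (c j) ≠ 0 := nonZeroDivisors.ne_zero (reesChartBase_mem_nonZeroDivisors _ _)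
  have hcj : c j ≠ 0 := fun h0 => hφcj ((congrArg (chartBase c j) h0).trans (map_zero _))
  have hθ : ψ (c j) ≠ 0 := fun h0 => hcj (hψ (by rw [h0, map_zero]))
  -- the chart read in `K` through `x'` IS `chartToField`
  have hga : ∀ a, F (hπ.stalkEmb x' (χ (chartBase c j a))) = ψ a := by
    intro a
    have h1 : χ (chartBase c j a) = (π.stalkMap x').hom a := hχ a
    rw [h1, hπ.stalkEmb_stalkMap, ← hFθ]
    rfl
  have hg : (F.comp (hπ.stalkEmb x')).comp χ = chartToField c j ψ hθ := by
    refine ringHom_ext_chartBase c j ?_ ?_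
    · refine RingHom.ext fun a => ?_
      show F (hπ.stalkEmb x' (χ (chartBase c j a))) = chartToField c j ψ hθ (chartBase c j a)
      rw [hga, chartToField_reesChartBase]
    · show F (hπ.stalkEmb x' (χ (chartBase c j (c j)))) ≠ 0
      rw [hga]; exact hθ
  have hgb : ∀ b, F (hπ.stalkEmb x' (χ b)) = chartToField c j ψ hθ b := fun b => RingHom.congr_fun hg b
  -- every `c_i / c_j` lies in `𝒪_{X',x'} ⊆ O`: `c_j` has maximal value
  have hmin : ∀ i, O.valuation (ψ (c i)) ≤ O.valuation (ψ (c j)) := by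
    intro i
    have h1 : F (hπ.stalkEmb x' (χ (chartGen c j i))) = ψ (c i) / ψ (c j) := by
      rw [hgb]; exact chartToField_chartGen c j ψ hθ i
    have h2' := hO (χ (chartGen c j i))
    rw [h1] at h2'
    have h2 : O.valuation (ψ (c i) / ψ (c j)) ≤ 1 := (O.valuation_le_one_iff _).mpr h2'
    rw [map_div₀] at h2
    have hpos : 0 < O.valuation (ψ (c j)) := by
      rw [Valuation.pos_iff]; exact hθ
    exact (div_le_one₀ hpos).mp h2
  -- `x'` sits at the centre of `O` on the chart
  have hw : w.asIdeal = chartCentre c j ψ hθ O hRO' hmin := by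
    refine Ideal.ext fun b => ?_
    rw [mem_chartCentre_iff, ← hgb,
      ← IsLocalization.AtPrime.to_map_mem_maximal_iff (X'.presheaf.stalk x') w.asIdeal b inferInstance,
      mem_maximalIdeal_iff_valuation_map_lt_one_of_dominates O (F.comp (hπ.stalkEmb x')) hO hdom]
    exact Iff.rfl
  -- the chart computation
  have hrange := hπ.range_comp_stalkEmb_of_chart O x' (π x') rfl c hc' j F ψ hFθ hθ hRO' hmin R hR q w hw hqw hsq
  rw [hrange]
  -- … is the quadratic transform along `O`
  haveI : IsNoetherianRing R :=
    isNoetherianRing_of_ringEquiv (X.presheaf.stalk (π x'))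
      ((RingEquiv.ofBijective ψ.rangeRestrict ⟨fun a b h => hψ (congrArg Subtype.val h), ψ.rangeRestrict_surjective⟩).trans
        (RingEquiv.subringCongr hR))
  have hcjm : c j ∈ maximalIdeal (X.presheaf.stalk (π x')) := hc' ▸ Ideal.subset_span ⟨j, rfl⟩
  have hmemRj : (⟨ψ (c j), hmemR (c j)⟩ : R) ∈ maximalIdeal R := by
    rw [mem_maximalIdeal_iff_of_range_eq O ψ hψ R hR hdom₀]
    exact (hdom₀ _).mp hcjm
  have hmax : ∀ y ∈ maximalIdeal R, O.valuation (y : K) ≤ O.valuation ((⟨ψ (c j), hmemR (c j)⟩ : R) : K) := by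
    intro y hy
    obtain ⟨a, ha⟩ : (y : K) ∈ ψ.range := hR ▸ y.2
    have hya : O.valuation (y : K) < 1 := (mem_maximalIdeal_iff_of_range_eq O ψ hψ R hR hdom₀ y).mp hy
    have ham : a ∈ maximalIdeal (X.presheaf.stalk (π x')) := (hdom₀ a).mpr (ha ▸ hya)
    have hspan : a ∈ Ideal.span (Set.range c) := hc'.symm ▸ ham
    have h := valuation_map_le_of_mem_span O ψ hRO' c j hmin hspan
    rw [ha] at h
    exact h
  have hθ' : ((⟨ψ (c j), hmemR (c j)⟩ : R) : K) ≠ 0 := hθ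
  have key := isQuadraticTransformAlong_of_max (O := O) hRO hmemRj hθ' hmax
  exact key

/-- **THE LOCAL RING OF A PRESCRIBED POINT OF THE POINT BLOW-UP, DOMINATED BY `O`, IS THE QUADRATIC TRANSFORM ALONG `O`** — intrinsic form:
`IsQuadraticTransformAlong O (F ∘ (𝒪_{X,π x'} ⊆ K(X))).range (F ∘ ε_{x'}).range`. [cite: StacksProject, Tag 0804] [cite: Cutkosky2014, §2.2] -/
theorem IsBlowup.isQuadraticTransformAlong_range_stalkEmb (hπ : IsBlowup π J) (x' : X')
    (hJ : stalkIdeal J (π x') = maximalIdeal (X.presheaf.stalk (π x')))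
    (F : X.functionField →+* K)
    (hO : ∀ r, F (hπ.stalkEmb x' r) ∈ O)
    (hdom : ∀ r, r ∈ maximalIdeal (X'.presheaf.stalk x') → O.valuation (F (hπ.stalkEmb x' r)) < 1) :
    haveI : IsLocalRing (F.comp (algebraMap (X.presheaf.stalk (π x')) X.functionField)).range :=
      isLocalRing_of_range_eq _ _ rfl
    IsQuadraticTransformAlong O (F.comp (algebraMap (X.presheaf.stalk (π x')) X.functionField)).range
      (F.comp (hπ.stalkEmb x')).range :=
  haveI : IsLocalRing (F.comp (algebraMap (X.presheaf.stalk (π x')) X.functionField)).range :=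
    isLocalRing_of_range_eq _ _ rfl
  hπ.isQuadraticTransformAlong_range_stalkEmb_of_range_eq O x' hJ F _ rfl _ rfl hO hdom

end Literature.AlgebraicGeometry.Resolution

end
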